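import Literature.NumberTheory.EllipticCurves.IwasawaAlgebraEisensteinValueMapTwoInjectiveProofs
import Literature.NumberTheory.GaloisCohomology.Howard2004.DualityDatumLocalValueDivisibleProofs
import Literature.NumberTheory.EllipticCurves.ZpExtensionEisensteinDVRSettingH4ReadingsProofs
import HarnessLib

/-!
# H.4 at the places `v ∣ p` for the curve's Eisenstein setting, X: the VALUE MAPS `ι : A_{m,a} ↪ A_{m,b}` (`ι ∘ reduce = p^c ·`)
# on `H²(K_v, A_{m,•}(1))` — `Λ`-semilinearity, compatibility with the reductions, and «`p^{i+1}`-torsion ⊆ range ι»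
# (the inputs `hιS`, `hιred`, `hιrange` of (EXACT-REP) `Tower.exists_sub_pow_smul_forall_pairing_eq_zero`; `hιinj` is
# `IwasawaAlgebraEisensteinValueMapTwoInjectiveProofs`)

`Proofs` file (theorems only; no definition, no named fact, no instance, no `sorry`).

* §1 (rings) `EisensteinCoeff.apply_mk_mul_of_apply_reduce` (`ι ([g] x) = [g] ι(x)` for `g ∈ Λ`),
  `EisensteinCoeff.reduce_apply_eq_apply_reduce_of_apply_reduce` (two value maps with the same exponent commute with the
  reductions);
* §2 (generic `H²`) `Howard2004.cohomologyMap_two_comp_apply` / `cohomologyMap_two_square_apply` (functoriality of `H²` along a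
  commuting triangle / square of coefficient maps, pointwise form), `Howard2004.cohomologyMap_two_eq_pow_smul_of_hom_apply` / `…_of_apply` (`H²`
  of «`x ↦ p^c x`» is `p^c ·`);
* §3 (the curve's tower, ANY H.4 data `D k` over `A_{m,k+1}`) `reduce_twistOne_of_le`, `eisensteinTower_valueMap_scalarMap` (hιS, scalars `g ∈ Λ` acting by
  `H²([g] ·)`), `eisensteinTower_valueMap_red` (hιred), `eisensteinTower_valueMap_apply_red_eq_pow_smul` (`H²(ι) ∘ H²(reduce) = p^c ·`),
  `eisensteinTower_valueMap_range` (hιrange at a finite place, from `DualityDatum.exists_eq_pow_smul_of_pow_smul_eq_zero` and the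
  Poitou–Tate named fact: a `p^{i+1}`-torsion class of `H²(K_v, A_{m,k+2+i}(1))` is `p^{k+1} W = H²(ι)(H²(reduce) W)`).

Cell `pub/bsd-print-x9` (STUB A `hfin4` at `v ∣ p`, (EXACT-REP-INST)).  No summit statement is proved here; BSD is not proved by any
of this.  References: [Howard2004HeegnerKolyvagin] Def. 1.1.3, §1.3 H.4, §1.6, §2.2 (arXiv:1202.6340 p. 5, p. 7, p. 11);
[MilneADT2006] I Cor. 2.3; [SerreGaloisCohomology1997] I §2.2–2.3.
-/

set_option autoImplicit false

noncomputable section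

open Function NumberField IsDedekindDomain Field CategoryTheory
open scoped NumberField ContRepresentation

/-! ## §1 Ring level -/

namespace Literature.NumberTheory.EllipticCurves.IwasawaAlgebra.EisensteinCoeff

variable {p : ℕ} [hp : Fact p.Prime]

/-- **Value maps are `Λ`-semilinear**: `ι ([g]_a · x) = [g]_b · ι x` for `g ∈ Λ` (`[g]_k` its class in `A_{m,k}`), for any additive
`ι : A_{m,a} → A_{m,b}` with `ι ∘ reduce = p^c ·`. [cite: Howard2004HeegnerKolyvagin, Def. 1.1.3 and §2.2] -/
theorem apply_mk_mul_of_apply_reduce (m : ℕ) {a b : ℕ} (hab : a ≤ b) (ι : EisensteinCoeff p m a →+ EisensteinCoeff p m b) (c : ℕ)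
    (hι : ∀ x : EisensteinCoeff p m b, ι (reduce p m hab x) = p ^ c • x) (g : IwasawaAlgebra p) (x : EisensteinCoeff p m a) :
    ι (Ideal.Quotient.mk _ g * x) = Ideal.Quotient.mk _ g * ι x := by
  obtain ⟨y, rfl⟩ := reduce_surjective m hab x
  rw [← reduce_mk m hab g, ← map_mul, hι, hι, mul_smul_comm]

/-- **Value maps with the same exponent commute with the reductions**: for additive `ι : A_{m,a} → A_{m,b}`, `ι′ : A_{m,a′} → A_{m,b′}`
(`a′ ≤ a`, `b′ ≤ b`) with `ι ∘ reduce = p^c ·` and `ι′ ∘ reduce = p^c ·`: `reduce (ι x) = ι′ (reduce x)`.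
[cite: Howard2004HeegnerKolyvagin, Def. 1.1.3 and §1.6 (arXiv p. 11, L33–38)] -/
theorem reduce_apply_eq_apply_reduce_of_apply_reduce (m : ℕ) {a b a' b' : ℕ} (hab : a ≤ b) (hab' : a' ≤ b') (ha : a' ≤ a)
    (hb : b' ≤ b) (c : ℕ) (ι : EisensteinCoeff p m a →+ EisensteinCoeff p m b)
    (hι : ∀ x : EisensteinCoeff p m b, ι (reduce p m hab x) = p ^ c • x)
    (ι' : EisensteinCoeff p m a' →+ EisensteinCoeff p m b')
    (hι' : ∀ x : EisensteinCoeff p m b', ι' (reduce p m hab' x) = p ^ c • x) (x : EisensteinCoeff p m a) :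
    reduce p m hb (ι x) = ι' (reduce p m ha x) := by
  obtain ⟨y, rfl⟩ := reduce_surjective m hab x
  rw [hι, map_nsmul, reduce_reduce, ← reduce_reduce m hab' hb, hι']

end Literature.NumberTheory.EllipticCurves.IwasawaAlgebra.EisensteinCoeff

/-! ## §2 Generic `H²` helpers -/

namespace Literature.NumberTheory.GaloisCohomology.Howard2004

open Literature.NumberTheory.GaloisRepresentations

/-- **`H²` along a commuting triangle of coefficient maps**: for continuous representations `τ₁, τ₂, τ₃` and additive equivariant
`f₁₂, f₂₃, f₁₃` with `f₂₃ ∘ f₁₂ = f₁₃` pointwise, `H²(f₂₃) (H²(f₁₂) q) = H²(f₁₃) q`. [cite: SerreGaloisCohomology1997, Ch. I §2.2] -/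
theorem cohomologyMap_two_comp_apply {G : Type} [Group G] [TopologicalSpace G] [IsTopologicalGroup G]
    {V₁ V₂ V₃ : Type} [AddCommGroup V₁] [TopologicalSpace V₁] [DiscreteTopology V₁]
    [AddCommGroup V₂] [TopologicalSpace V₂] [DiscreteTopology V₂] [AddCommGroup V₃] [TopologicalSpace V₃] [DiscreteTopology V₃]
    (τ₁ : ContinuousRep G ℤ V₁) (τ₂ : ContinuousRep G ℤ V₂) (τ₃ : ContinuousRep G ℤ V₃)
    (f₁₂ : V₁ →+ V₂) (h₁₂ : ∀ (g : G) (x : V₁), f₁₂ (τ₁ g x) = τ₂ g (f₁₂ x))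
    (f₂₃ : V₂ →+ V₃) (h₂₃ : ∀ (g : G) (x : V₂), f₂₃ (τ₂ g x) = τ₃ g (f₂₃ x))
    (f₁₃ : V₁ →+ V₃) (h₁₃ : ∀ (g : G) (x : V₁), f₁₃ (τ₁ g x) = τ₃ g (f₁₃ x))
    (htri : ∀ x, f₂₃ (f₁₂ x) = f₁₃ x) (q : τ₁.cohomology 2) :
    ContinuousRep.cohomologyMap τ₂ τ₃ f₂₃ continuous_of_discreteTopology h₂₃ 2
        (ContinuousRep.cohomologyMap τ₁ τ₂ f₁₂ continuous_of_discreteTopology h₁₂ 2 q) =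
      ContinuousRep.cohomologyMap τ₁ τ₃ f₁₃ continuous_of_discreteTopology h₁₃ 2 q := by
  let α₁₂ : τ₁.toTopRep ⟶ τ₂.toTopRep :=
    TopRep.ofHom ⟨⟨f₁₂.toIntLinearMap, continuous_of_discreteTopology⟩, fun g => ContinuousLinearMap.ext fun x => h₁₂ g x⟩
  let α₂₃ : τ₂.toTopRep ⟶ τ₃.toTopRep :=
    TopRep.ofHom ⟨⟨f₂₃.toIntLinearMap, continuous_of_discreteTopology⟩, fun g => ContinuousLinearMap.ext fun x => h₂₃ g x⟩
  let α₁₃ : τ₁.toTopRep ⟶ τ₃.toTopRep :=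
    TopRep.ofHom ⟨⟨f₁₃.toIntLinearMap, continuous_of_discreteTopology⟩, fun g => ContinuousLinearMap.ext fun x => h₁₃ g x⟩
  exact (map_comp_apply_of (ContinuousMonoidHom.id G) (ContinuousMonoidHom.id G) (ContinuousMonoidHom.id G) (fun _ => rfl)
    (resIdHom α₁₂) (resIdHom α₂₃) (resIdHom α₁₃) (fun x => (htri x).symm) 2 q).symm

/-- **`H²` along a commuting square of coefficient maps**: for additive equivariant `f₁₂, f₂₄, f₁₃, f₃₄` with
`f₂₄ ∘ f₁₂ = f₃₄ ∘ f₁₃` pointwise, `H²(f₂₄) (H²(f₁₂) q) = H²(f₃₄) (H²(f₁₃) q)`. [cite: SerreGaloisCohomology1997, Ch. I §2.2] -/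
theorem cohomologyMap_two_square_apply {G : Type} [Group G] [TopologicalSpace G] [IsTopologicalGroup G]
    {V₁ V₂ V₃ V₄ : Type} [AddCommGroup V₁] [TopologicalSpace V₁] [DiscreteTopology V₁]
    [AddCommGroup V₂] [TopologicalSpace V₂] [DiscreteTopology V₂] [AddCommGroup V₃] [TopologicalSpace V₃] [DiscreteTopology V₃]
    [AddCommGroup V₄] [TopologicalSpace V₄] [DiscreteTopology V₄]
    (τ₁ : ContinuousRep G ℤ V₁) (τ₂ : ContinuousRep G ℤ V₂) (τ₃ : ContinuousRep G ℤ V₃) (τ₄ : ContinuousRep G ℤ V₄)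
    (f₁₂ : V₁ →+ V₂) (h₁₂ : ∀ (g : G) (x : V₁), f₁₂ (τ₁ g x) = τ₂ g (f₁₂ x))
    (f₂₄ : V₂ →+ V₄) (h₂₄ : ∀ (g : G) (x : V₂), f₂₄ (τ₂ g x) = τ₄ g (f₂₄ x))
    (f₁₃ : V₁ →+ V₃) (h₁₃ : ∀ (g : G) (x : V₁), f₁₃ (τ₁ g x) = τ₃ g (f₁₃ x))
    (f₃₄ : V₃ →+ V₄) (h₃₄ : ∀ (g : G) (x : V₃), f₃₄ (τ₃ g x) = τ₄ g (f₃₄ x))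
    (hsq : ∀ x, f₂₄ (f₁₂ x) = f₃₄ (f₁₃ x)) (q : τ₁.cohomology 2) :
    ContinuousRep.cohomologyMap τ₂ τ₄ f₂₄ continuous_of_discreteTopology h₂₄ 2
        (ContinuousRep.cohomologyMap τ₁ τ₂ f₁₂ continuous_of_discreteTopology h₁₂ 2 q) =
      ContinuousRep.cohomologyMap τ₃ τ₄ f₃₄ continuous_of_discreteTopology h₃₄ 2
        (ContinuousRep.cohomologyMap τ₁ τ₃ f₁₃ continuous_of_discreteTopology h₁₃ 2 q) := by
  have h14 : ∀ (g : G) (x : V₁), (f₂₄.comp f₁₂) (τ₁ g x) = τ₄ g ((f₂₄.comp f₁₂) x) := fun g x ↦ by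
    rw [AddMonoidHom.comp_apply, AddMonoidHom.comp_apply, h₁₂, h₂₄]
  rw [cohomologyMap_two_comp_apply τ₁ τ₂ τ₄ f₁₂ h₁₂ f₂₄ h₂₄ (f₂₄.comp f₁₂) h14 (fun _ => rfl) q,
    cohomologyMap_two_comp_apply τ₁ τ₃ τ₄ f₁₃ h₁₃ f₃₄ h₃₄ (f₂₄.comp f₁₂) h14 (fun x => (hsq x).symm) q]

/-- **`H²` of an endomorphism acting as `x ↦ p^c · x` is `p^c ·` on `H²`** (`G` locally compact, so that `H²` is computed by
continuous inhomogeneous `2`-cocycles: the class of `p^c` times the cocycle) — `TopRep` form. [cite: SerreGaloisCohomology1997, Ch. I §2.2–2.3] -/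
theorem cohomologyMap_two_eq_pow_smul_of_hom_apply {G : Type} [Group G] [TopologicalSpace G] [IsTopologicalGroup G]
    [LocallyCompactSpace G] {A : TopRep.{0} ℤ G} (α : A ⟶ A) (p c : ℕ) (hα : ∀ x, α.hom x = p ^ c • x)
    (q : continuousCohomology 2 A) : cohomologyMap α 2 q = p ^ c • q := by
  obtain ⟨z, rfl⟩ := twoCocycleClass_surjective A q
  rw [cohomologyMap_twoCocycleClass, ← twoCocycleClassₗ_apply, ← twoCocycleClassₗ_apply, ← map_nsmul]
  congr 1
  exact Subtype.ext (ContinuousMap.ext fun στ ↦ by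
    obtain ⟨σ, σ'⟩ := στ
    rw [pullback₂_id_resIdHom_apply]
    exact hα _)

/-- **`H²` of an additive equivariant endomorphism acting as `x ↦ p^c · x` is `p^c ·` on `H²`** — `ContinuousRep.cohomologyMap` form.
[cite: SerreGaloisCohomology1997, Ch. I §2.2–2.3] -/
theorem cohomologyMap_two_eq_pow_smul_of_apply {G : Type} [Group G] [TopologicalSpace G] [IsTopologicalGroup G]
    [LocallyCompactSpace G] {V : Type} [AddCommGroup V] [TopologicalSpace V] [DiscreteTopology V] (τ : ContinuousRep G ℤ V)
    (f : V →+ V) (h : ∀ (g : G) (x : V), f (τ g x) = τ g (f x)) (p c : ℕ) (hf : ∀ x, f x = p ^ c • x)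
    (q : τ.cohomology 2) :
    ContinuousRep.cohomologyMap τ τ f continuous_of_discreteTopology h 2 q = p ^ c • q :=
  cohomologyMap_two_eq_pow_smul_of_hom_apply (A := τ.toTopRep)
    (TopRep.ofHom ⟨⟨f.toIntLinearMap, continuous_of_discreteTopology⟩, fun g => ContinuousLinearMap.ext fun x => h g x⟩) p c
    (fun x => hf x) q

end Literature.NumberTheory.GaloisCohomology.Howard2004

/-! ## §3 The value maps on `H²(K_v, A_{m,•}(1))` for the curve's tower -/

namespace WeierstrassCurve

open Literature.NumberTheory.EllipticCurves Literature.NumberTheory.GaloisRepresentations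
open Literature.NumberTheory.GaloisRepresentations.DiscreteGaloisModule
open Literature.NumberTheory.GaloisCohomology Literature.NumberTheory.GaloisCohomology.Howard2004
open Literature.NumberTheory.EllipticCurves.ZpExtension (EisensteinLevel)

variable {K : Type} [Field K] [NumberField K] (W : WeierstrassCurve ℚ) [W.IsElliptic] {p : ℕ} [hp : Fact p.Prime]
  (κ : ZpExtension K p) {m : ℕ} (hm : 1 ≤ m) (cd : ConjugationDatum K)
  (D : letI := IwasawaAlgebra.isLocalRing_quotient_X_pow_add_C p hm
    ∀ k, DualityDatum p cd ((W.eisensteinTower κ hm).ρ k) (IwasawaAlgebra.EisensteinCoeff p m (k + 1)))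

/-- `reduce ∘ (D b)(1) = (D a)(1) ∘ reduce` on `A_{m,b+1} → A_{m,a+1}` (the Tate twists of the level rings are compatible with every
reduction). [cite: Howard2004HeegnerKolyvagin, §1.3 H.4 and §1.6] -/
theorem reduce_twistOne_of_le {a b : ℕ} (hab : a + 1 ≤ b + 1) (g : absoluteGaloisGroup K)
    (x : IwasawaAlgebra.EisensteinCoeff p m (b + 1)) :
    letI := IwasawaAlgebra.isLocalRing_quotient_X_pow_add_C p hm
    IwasawaAlgebra.EisensteinCoeff.reduce p m hab ((D b).twistOne g x) =
      (D a).twistOne g (IwasawaAlgebra.EisensteinCoeff.reduce p m hab x) := by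
  letI := IwasawaAlgebra.isLocalRing_quotient_X_pow_add_C p hm
  rw [(D b).twistOne_apply, (D a).twistOne_apply, map_mul, IwasawaAlgebra.EisensteinCoeff.reduce_algebraMap]

/-- **hιS: the value maps on `H²(K_v, A_{m,•}(1))` are `Λ`-semilinear** — `H²(ι) (H²([g]_a ·) q) = H²([g]_b ·) (H²(ι) q)` for `g ∈ Λ`,
for any additive `ι : A_{m,a+1} → A_{m,b+1}` with `ι ∘ reduce = p^c ·` and ANY H.4 data.
[cite: Howard2004HeegnerKolyvagin, Def. 1.1.3, §1.3 H.4 and §1.6 (arXiv p. 11, L33–38)] [cite: SerreGaloisCohomology1997, Ch. I §2.2] -/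
theorem eisensteinTower_valueMap_scalarMap {a b : ℕ} (hab : a + 1 ≤ b + 1)
    (ι : IwasawaAlgebra.EisensteinCoeff p m (a + 1) →+ IwasawaAlgebra.EisensteinCoeff p m (b + 1)) (c : ℕ)
    (hι : ∀ x, ι (IwasawaAlgebra.EisensteinCoeff.reduce p m hab x) = p ^ c • x) (v : Place K) (g : IwasawaAlgebra p)
    (q : letI := IwasawaAlgebra.isLocalRing_quotient_X_pow_add_C p hm
      galoisCohomology ((D a).twistOne.toLocal v) 2) :
    letI := IwasawaAlgebra.isLocalRing_quotient_X_pow_add_C p hm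
    ContinuousRep.cohomologyMap ((D a).twistOne.toLocal v) ((D b).twistOne.toLocal v) ι continuous_of_discreteTopology
        (fun _ z => (D a).twistOne_apply_of_apply_reduce (D b) hab ι (p ^ c) hι _ z) 2
        (galoisCohomology.scalarMap ((D a).twistOne.toLocal v)
          (DualityDatum.isScalarLinear_toLocal (D a).isScalarLinear_twistOne v) 2 (Ideal.Quotient.mk _ g) q) =
      galoisCohomology.scalarMap ((D b).twistOne.toLocal v)
        (DualityDatum.isScalarLinear_toLocal (D b).isScalarLinear_twistOne v) 2 (Ideal.Quotient.mk _ g)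
        (ContinuousRep.cohomologyMap ((D a).twistOne.toLocal v) ((D b).twistOne.toLocal v) ι continuous_of_discreteTopology
          (fun _ z => (D a).twistOne_apply_of_apply_reduce (D b) hab ι (p ^ c) hι _ z) 2 q) := by
  letI := IwasawaAlgebra.isLocalRing_quotient_X_pow_add_C p hm
  exact cohomologyMap_two_square_apply ((D a).twistOne.toLocal v) ((D a).twistOne.toLocal v) ((D b).twistOne.toLocal v)
    ((D b).twistOne.toLocal v)
    (DistribSMul.toAddMonoidHom _ (Ideal.Quotient.mk _ g : IwasawaAlgebra.EisensteinCoeff p m (a + 1)))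
    (fun g' x ↦ ((DualityDatum.isScalarLinear_toLocal (D a).isScalarLinear_twistOne v) g' _ x).symm)
    ι (fun _ z => (D a).twistOne_apply_of_apply_reduce (D b) hab ι (p ^ c) hι _ z)
    ι (fun _ z => (D a).twistOne_apply_of_apply_reduce (D b) hab ι (p ^ c) hι _ z)
    (DistribSMul.toAddMonoidHom _ (Ideal.Quotient.mk _ g : IwasawaAlgebra.EisensteinCoeff p m (b + 1)))
    (fun g' x ↦ ((DualityDatum.isScalarLinear_toLocal (D b).isScalarLinear_twistOne v) g' _ x).symm)
    (fun x ↦ by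
      rw [DistribSMul.toAddMonoidHom_apply, DistribSMul.toAddMonoidHom_apply, smul_eq_mul, smul_eq_mul]
      exact IwasawaAlgebra.EisensteinCoeff.apply_mk_mul_of_apply_reduce m hab ι c hι g x) q

/-- **hιred: the value maps commute with the reductions on `H²`** — `H²(reduce) (H²(ι₁) q) = H²(ι₀) (H²(reduce) q)` for value maps
`ι₁ : A_{m,a+2} → A_{m,b+2}`, `ι₀ : A_{m,a+1} → A_{m,b+1}` with the same exponent, ANY H.4 data.
[cite: Howard2004HeegnerKolyvagin, Def. 1.1.3 and §1.6 (arXiv p. 11, L33–38)] [cite: SerreGaloisCohomology1997, Ch. I §2.2] -/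
theorem eisensteinTower_valueMap_red {a b : ℕ} (c : ℕ) (h₁ : a + 1 + 1 ≤ b + 1 + 1)
    (ι₁ : IwasawaAlgebra.EisensteinCoeff p m (a + 1 + 1) →+ IwasawaAlgebra.EisensteinCoeff p m (b + 1 + 1))
    (hι₁ : ∀ x, ι₁ (IwasawaAlgebra.EisensteinCoeff.reduce p m h₁ x) = p ^ c • x) (h₀ : a + 1 ≤ b + 1)
    (ι₀ : IwasawaAlgebra.EisensteinCoeff p m (a + 1) →+ IwasawaAlgebra.EisensteinCoeff p m (b + 1))
    (hι₀ : ∀ x, ι₀ (IwasawaAlgebra.EisensteinCoeff.reduce p m h₀ x) = p ^ c • x) (v : Place K)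
    (q : letI := IwasawaAlgebra.isLocalRing_quotient_X_pow_add_C p hm
      galoisCohomology ((D (a + 1)).twistOne.toLocal v) 2) :
    letI := IwasawaAlgebra.isLocalRing_quotient_X_pow_add_C p hm
    ContinuousRep.cohomologyMap ((D (b + 1)).twistOne.toLocal v) ((D b).twistOne.toLocal v)
        (IwasawaAlgebra.EisensteinCoeff.reduce p m (Nat.le_succ (b + 1))).toAddMonoidHom
        continuous_of_discreteTopology (fun _ z => W.reduce_twistOne κ hm cd D b _ z) 2
        (ContinuousRep.cohomologyMap ((D (a + 1)).twistOne.toLocal v) ((D (b + 1)).twistOne.toLocal v) ι₁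
          continuous_of_discreteTopology (fun _ z => (D (a + 1)).twistOne_apply_of_apply_reduce (D (b + 1)) h₁ ι₁ (p ^ c) hι₁ _ z) 2 q) =
      ContinuousRep.cohomologyMap ((D a).twistOne.toLocal v) ((D b).twistOne.toLocal v) ι₀ continuous_of_discreteTopology
        (fun _ z => (D a).twistOne_apply_of_apply_reduce (D b) h₀ ι₀ (p ^ c) hι₀ _ z) 2
        (ContinuousRep.cohomologyMap ((D (a + 1)).twistOne.toLocal v) ((D a).twistOne.toLocal v)
          (IwasawaAlgebra.EisensteinCoeff.reduce p m (Nat.le_succ (a + 1))).toAddMonoidHom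
          continuous_of_discreteTopology (fun _ z => W.reduce_twistOne κ hm cd D a _ z) 2 q) := by
  letI := IwasawaAlgebra.isLocalRing_quotient_X_pow_add_C p hm
  exact cohomologyMap_two_square_apply _ _ _ _ _ _ _ _ _ _ _ _
    (fun x ↦ IwasawaAlgebra.EisensteinCoeff.reduce_apply_eq_apply_reduce_of_apply_reduce m h₁ h₀ (Nat.le_succ (a + 1))
      (Nat.le_succ (b + 1)) c ι₁ hι₁ ι₀ hι₀ x) q

/-- **`H²(ι) (H²(reduce) W) = p^c · W`** on `H²(K_v, A_{m,b+1}(1))` for a value map `ι : A_{m,a+1} → A_{m,b+1}` with `ι ∘ reduce = p^c ·`.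
[cite: Howard2004HeegnerKolyvagin, Def. 1.1.3 and §1.6] [cite: SerreGaloisCohomology1997, Ch. I §2.2–2.3] -/
theorem eisensteinTower_valueMap_apply_red_eq_pow_smul {a b : ℕ} (hab : a + 1 ≤ b + 1)
    (ι : IwasawaAlgebra.EisensteinCoeff p m (a + 1) →+ IwasawaAlgebra.EisensteinCoeff p m (b + 1)) (c : ℕ)
    (hι : ∀ x, ι (IwasawaAlgebra.EisensteinCoeff.reduce p m hab x) = p ^ c • x) (v : Place K)
    (q : letI := IwasawaAlgebra.isLocalRing_quotient_X_pow_add_C p hm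
      galoisCohomology ((D b).twistOne.toLocal v) 2) :
    letI := IwasawaAlgebra.isLocalRing_quotient_X_pow_add_C p hm
    ContinuousRep.cohomologyMap ((D a).twistOne.toLocal v) ((D b).twistOne.toLocal v) ι continuous_of_discreteTopology
        (fun _ z => (D a).twistOne_apply_of_apply_reduce (D b) hab ι (p ^ c) hι _ z) 2
        (ContinuousRep.cohomologyMap ((D b).twistOne.toLocal v) ((D a).twistOne.toLocal v)
          (IwasawaAlgebra.EisensteinCoeff.reduce p m hab).toAddMonoidHom continuous_of_discreteTopology
          (fun _ z => W.reduce_twistOne_of_le κ hm cd D hab _ z) 2 q) = p ^ c • q := by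
  letI := IwasawaAlgebra.isLocalRing_quotient_X_pow_add_C p hm
  haveI : CompactSpace (absoluteGaloisGroup (Place.Completion v)) := absoluteGaloisGroup_compactSpace _
  have hsm : ∀ (g : absoluteGaloisGroup (Place.Completion v)) (x : IwasawaAlgebra.EisensteinCoeff p m (b + 1)),
      (DistribSMul.toAddMonoidHom _ ((p ^ c : ℕ) : IwasawaAlgebra.EisensteinCoeff p m (b + 1))) (((D b).twistOne.toLocal v) g x) =
        ((D b).twistOne.toLocal v) g
          ((DistribSMul.toAddMonoidHom _ ((p ^ c : ℕ) : IwasawaAlgebra.EisensteinCoeff p m (b + 1))) x) :=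
    fun g x ↦ ((DualityDatum.isScalarLinear_toLocal (D b).isScalarLinear_twistOne v) g _ x).symm
  have hpc : ∀ x : IwasawaAlgebra.EisensteinCoeff p m (b + 1),
      (DistribSMul.toAddMonoidHom _ ((p ^ c : ℕ) : IwasawaAlgebra.EisensteinCoeff p m (b + 1))) x = p ^ c • x := fun x ↦ by
    rw [DistribSMul.toAddMonoidHom_apply, smul_eq_mul, nsmul_eq_mul]
  rw [cohomologyMap_two_comp_apply ((D b).twistOne.toLocal v) ((D a).twistOne.toLocal v) ((D b).twistOne.toLocal v)
    (IwasawaAlgebra.EisensteinCoeff.reduce p m hab).toAddMonoidHom (fun _ z => W.reduce_twistOne_of_le κ hm cd D hab _ z) ι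
    (fun _ z => (D a).twistOne_apply_of_apply_reduce (D b) hab ι (p ^ c) hι _ z) _ hsm
    (fun x ↦ by rw [hpc, RingHom.toAddMonoidHom_eq_coe, AddMonoidHom.coe_coe]; exact hι x) q]
  exact cohomologyMap_two_eq_pow_smul_of_apply _ _ hsm p c hpc q

/-- **hιrange at a finite place: the `p^{i+1}`-torsion of `H²(K_v, A_{m,k+2+i}(1))` lies in the range of `H²(ι)`** for a value map
`ι : A_{m,i+1} → A_{m,k+2+i}` with `ι ∘ reduce = p^{k+1} ·`, ANY H.4 data, given the Poitou–Tate named fact: such a class is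
`p^{k+1} W` (`DualityDatum.exists_eq_pow_smul_of_pow_smul_eq_zero` with the tail form, a logarithm of `μ_{p^{k+2+i}}`, the dual family
and the local invariant `inv_v`), and `p^{k+1} W = H²(ι) (H²(reduce) W)`.
[cite: Howard2004HeegnerKolyvagin, §1.3 H.4 and §1.6 (arXiv p. 11, L33–38)] [cite: MilneADT2006, Ch. I, Cor. 2.3] -/
theorem eisensteinTower_valueMap_range (hPT : poitouTate_selmerStructure_duality K) (v : HeightOneSpectrum (𝓞 K)) (k i : ℕ)
    (hki : i + 1 ≤ k + 1 + i + 1)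
    (ι : IwasawaAlgebra.EisensteinCoeff p m (i + 1) →+ IwasawaAlgebra.EisensteinCoeff p m (k + 1 + i + 1))
    (hι : ∀ x, ι (IwasawaAlgebra.EisensteinCoeff.reduce p m hki x) = p ^ (k + 1) • x)
    (q : letI := IwasawaAlgebra.isLocalRing_quotient_X_pow_add_C p hm
      galoisCohomology ((D (k + 1 + i)).twistOne.toLocal (Sum.inr v)) 2) (hq : p ^ (i + 1) • q = 0) :
    letI := IwasawaAlgebra.isLocalRing_quotient_X_pow_add_C p hm
    q ∈ (ContinuousRep.cohomologyMap ((D i).twistOne.toLocal (Sum.inr v)) ((D (k + 1 + i)).twistOne.toLocal (Sum.inr v)) ι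
      continuous_of_discreteTopology (fun _ z => (D i).twistOne_apply_of_apply_reduce (D (k + 1 + i)) hki ι (p ^ (k + 1)) hι _ z) 2).range := by
  letI := IwasawaAlgebra.isLocalRing_quotient_X_pow_add_C p hm
  have hpp := hp.out
  have hpK : (p : K) ≠ 0 := by exact_mod_cast hpp.ne_zero
  -- readings data at level `n := k + 1 + i + 1`
  have hlam : ∀ (z : ℤ_[p]) (r : IwasawaAlgebra.EisensteinCoeff p m (k + 1 + i + 1)),
      (IwasawaAlgebra.EisensteinCoeff.tailFormZMod p hm (k + 1 + i + 1)).toAddMonoidHom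
          (algebraMap ℤ_[p] (IwasawaAlgebra.EisensteinCoeff p m (k + 1 + i + 1)) z * r) =
        PadicInt.toZModPow (k + 1 + i + 1) z *
          (IwasawaAlgebra.EisensteinCoeff.tailFormZMod p hm (k + 1 + i + 1)).toAddMonoidHom r := fun z r ↦ by
    rw [LinearMap.toAddMonoidHom_coe, IwasawaAlgebra.EisensteinCoeff.algebraMap_padicInt_eq_ofZMod_toZModPow p hm (k + 1 + i + 1),
      IwasawaAlgebra.EisensteinCoeff.tailFormZMod_ofZMod_mul]
  obtain ⟨log, hlogbij, hlogχ, -⟩ := exists_compatible_muLog K p hpK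
  let Lg : MuCarrier K (p ^ (k + 1 + i + 1)) ≃+ ZMod (p ^ (k + 1 + i + 1)) :=
    AddEquiv.ofBijective (log (k + 1 + i + 1)) (hlogbij (k + 1 + i + 1))
  have hexpb : Function.Bijective (Lg.symm : ZMod (p ^ (k + 1 + i + 1)) →+ MuCarrier K (p ^ (k + 1 + i + 1))) := Lg.symm.bijective
  have hexp : ∀ (g : absoluteGaloisGroup K) (x : ZMod (p ^ (k + 1 + i + 1))),
      (Lg.symm : ZMod (p ^ (k + 1 + i + 1)) →+ MuCarrier K (p ^ (k + 1 + i + 1))) (cyclotomicCharacterModPow K p (k + 1 + i + 1) g * x) =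
        mu K (p ^ (k + 1 + i + 1)) g ((Lg.symm : ZMod (p ^ (k + 1 + i + 1)) →+ MuCarrier K (p ^ (k + 1 + i + 1))) x) := fun g x ↦ by
    apply Lg.injective
    change Lg (Lg.symm _) = log (k + 1 + i + 1) (mu K _ g (Lg.symm x))
    rw [AddEquiv.apply_symm_apply, hlogχ, show log (k + 1 + i + 1) (Lg.symm x) = Lg (Lg.symm x) from rfl, AddEquiv.apply_symm_apply]
  have hbij := IwasawaAlgebra.EisensteinCoeff.bijective_comp_tailFormZMod_dualFamily_mul p hm (k + 1 + i + 1) _ hexpb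
  obtain ⟨inv, hperf, -, -, -⟩ := hPT (p ^ (k + 1 + i + 1))
  -- `q = p^{k+1} • W'`
  obtain ⟨W', hW'⟩ := (D (k + 1 + i)).exists_eq_pow_smul_of_pow_smul_eq_zero _ hlam _ hexp
    (IwasawaAlgebra.EisensteinCoeff.dualFamily p hm (k + 1 + i + 1)) hbij v (inv (Sum.inr v)) (hperf v).1 (i + 1) q hq
  rw [show k + 1 + i + 1 - (i + 1) = k + 1 by omega] at hW'
  refine ⟨ContinuousRep.cohomologyMap ((D (k + 1 + i)).twistOne.toLocal (Sum.inr v)) ((D i).twistOne.toLocal (Sum.inr v))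
    (IwasawaAlgebra.EisensteinCoeff.reduce p m hki).toAddMonoidHom continuous_of_discreteTopology
    (fun _ z => W.reduce_twistOne_of_le κ hm cd D hki _ z) 2 W', ?_⟩
  rw [hW']
  exact W.eisensteinTower_valueMap_apply_red_eq_pow_smul κ hm cd D hki ι (k + 1) hι (Sum.inr v) W'

end WeierstrassCurve

end
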